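import Literature.MathematicalPhysics.KineticTheory.LangevinChainLocalMinorization
import Literature.MathematicalPhysics.KineticTheory.LangevinChainMinorization
import Literature.MathematicalPhysics.KineticTheory.LangevinChainHarris
import Literature.MathematicalPhysics.KineticTheory.LangevinChainH2Proof
import Literature.MathematicalPhysics.KineticTheory.LangevinChainNESSProofs
import Literature.MathematicalPhysics.KineticTheory.LangevinChainGibbs
import HarnessLib

/-!
# Crux `ExtensiveSnapshotIrreversibility` (stmt-AtomisticToContinuum-9121), line `clausius-budget-sound-window`:
stub `stub_equilibriumKernelFacts`

Registered stub of the lead's checked skeleton `Cruxes/ExtensiveSnapshotIrreversibility/Lines/clausius-budget-sound-window.lean`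
(namespace `…Cruxes.ExtensiveSnapshotIrreversibility.ClausiusBudgetSoundWindow`), proved verbatim (name + signature) so that
`ledger propose --supports stmt-AtomisticToContinuum-9121` accepts it. See the skeleton's module docstring for the line and the
`let`-dictionary (`μT, g, Pg, k, w, Pw`).

The two kernel facts of the EQUILIBRIUM pinned chain (both baths at temperature `T > 0`, `N ≥ 1`)
consumed by every dynamic stub of the line, under the crux's weak-NESS-uniqueness guard:

* (INV) the Gibbs measure `μ_T = Z⁻¹ e^{-H/T} dq dp` is invariant for the constructed transition
  kernels `P_t = transitionKernel N T T t` (`μ_T.bind P_t = μ_T`, i.e. `Kernel.Invariant`);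
* (MIX) Cuneo–Eckmann–Hairer–Rey-Bellet 2018, (2.5): for every `0 < ϑ < 1/T` there are `C, c > 0`
  with `|P_t f(z) - μ_T(f)| ≤ C e^{ϑH(z)} e^{-ct}` for all continuous `f` with `|f| ≤ e^{ϑH}`.

Everything is assembled from proved tree theorems (`LangevinChainHarris.lean`,
`LangevinChainMinorization.lean`, `LangevinChainLocalMinorization.lean`, `LangevinChainH2Proof.lean`,
`LangevinChainNESSProofs.lean`, `LangevinChainGibbs.lean`); no named fact is taken as a hypothesis.
-/

noncomputable section

namespace Summit.AtomisticToContinuum.FouriersLaw.Theorems.ExtensiveSnapshotIrreversibility.ClausiusBudget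

open MeasureTheory Filter Topology
open scoped ENNReal NNReal
open Literature.MathematicalPhysics.KineticTheory.HeatConduction

/-- **Equilibrium kernel facts for the pinned chain** (`ω₂, lam, β, γ > 0`, `T > 0`, `N ≥ 1`),
under weak-NESS uniqueness `hU` of the pinned chain (any two `IsSteadyState N T_L T_R` measures
coincide). With `P = pinnedChain ω₂ lam β γ` and `μ_T = P.gibbsMeasure N T`:

* (INV) `μ_T.bind (P.transitionKernel N T T t) = μ_T` for every `t ≥ 0` — the Gibbs measure is
  invariant for the constructed equilibrium transition kernels;
* (MIX) for every `0 < ϑ < 1/T` there are `C, c > 0` such that for all `z`, `t ≥ 0` and all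
  continuous `f` with `|f| ≤ e^{ϑH}`,
  `|∫ f dP_t(z, ·) - ∫ f dμ_T| ≤ C e^{ϑH(z)} e^{-ct}` (CEHR (2.5) at equilibrium).

Proof. Let `S = pinnedChainSemigroup` be the constructed transition semigroup with
`T_L = T_R = T` (its kernels are `transitionKernel N T T t` by `rfl`). By the proved Lyapunov
condition H2 (`CuneoEckmannHairerReyBellet2018_H2_holds`) and Krylov–Bogoliubov
(`pinnedChainSemigroup_exists_isInvariant`) there is an invariant probability measure `μ⋆` of `S`
integrating `e^{ϑH}` for `ϑ < 1/max(T,T)`; by Dynkin's identity it is a weak steady state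
(`pinnedChain_isSteadyState_of_isInvariant`, bond currents dominated by `e^{ϑH}`), and so is the
Gibbs measure (`pinnedChain_isSteadyState_gibbsMeasure`); the guard `hU` gives `μ⋆ = μ_T`, whence
(INV). For (MIX), the Hörmander-free local small set at the equilibrium (`pinnedChain_localSmall`)
gives CEHR Prop. 3.6 (`pinnedChain_minorization_of_localSmall`), and Harris' theorem on the
skeleton chain plus (3.4) (`pinnedChainSemigroup_exp_convergence`) gives (2.5) for the invariant
probability measure `μ_T`, `1/max(T,T) = 1/T`.
[cite: CuneoEckmannHairerReyBellet2018, Thm 2.13 (2)-(3), Props 3.6-3.8 and §3.1] -/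
theorem stub_equilibriumKernelFacts :
    ∀ ω₂ lam β γ : ℝ, 0 < ω₂ → 0 < lam → 0 < β → 0 < γ →
      (∀ (N : ℕ) (T_L T_R : ℝ), 0 < T_L → 0 < T_R → ∀ μ ν : Measure (PhaseSpace N),
        (pinnedChain ω₂ lam β γ).IsSteadyState N T_L T_R μ →
        (pinnedChain ω₂ lam β γ).IsSteadyState N T_L T_R ν → μ = ν) →
      ∀ T : ℝ, 0 < T → ∀ N : ℕ, 0 < N →
        let P := pinnedChain ω₂ lam β γ
        let μT := P.gibbsMeasure N T
        (∀ t : ℝ≥0, μT.bind (P.transitionKernel N T T t) = μT) ∧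
        (∀ ϑ : ℝ, 0 < ϑ → ϑ < 1 / T → ∃ C c : ℝ, 0 < C ∧ 0 < c ∧
          ∀ (z : PhaseSpace N) (t : ℝ≥0) (f : PhaseSpace N → ℝ), Continuous f →
            (∀ y, |f y| ≤ Real.exp (ϑ * P.hamiltonian N y)) →
            |(∫ y, f y ∂(P.transitionKernel N T T t z)) - ∫ y, f y ∂μT| ≤
              C * Real.exp (ϑ * P.hamiltonian N z) * Real.exp (-c * t)) := by
  intro ω₂ lam β γ hω hl hβ hγ hU T hT N hN
  simp only []
  -- the constructed transition semigroup at equal temperatures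
  set S := pinnedChainSemigroup hω hl.le hβ.le hγ.le hN hT.le hT.le with hS
  have h2 : CuneoEckmannHairerReyBellet2018_H2 := CuneoEckmannHairerReyBellet2018_H2_holds
  -- Krylov–Bogoliubov: an invariant probability measure integrating `e^{ϑH}`
  obtain ⟨μs, hμs, hinv, hint⟩ :=
    pinnedChainSemigroup_exists_isInvariant hω hl.le hβ hγ hN hT hT h2
  have hTm : 0 < 1 / max T T := by positivity
  have hϑ₀ : 0 < 1 / max T T / 2 := by positivity
  have hϑ₁ : 1 / max T T / 2 < 1 / max T T := half_lt_self hTm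
  -- it is a weak steady state, and so is the Gibbs measure; uniqueness identifies them
  have hss : (pinnedChain ω₂ lam β γ).IsSteadyState N T T μs :=
    pinnedChain_isSteadyState_of_isInvariant hω.le hl.le hβ.le γ N S hinv hϑ₀ (hint _ hϑ₀ hϑ₁)
  have hgibbs : (pinnedChain ω₂ lam β γ).IsSteadyState N T T
      ((pinnedChain ω₂ lam β γ).gibbsMeasure N T) :=
    pinnedChain_isSteadyState_gibbsMeasure hω hl.le hβ.le γ N hT
  have heq : μs = (pinnedChain ω₂ lam β γ).gibbsMeasure N T := hU N T T hT hT μs _ hss hgibbs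
  have hinvG : S.IsInvariant ((pinnedChain ω₂ lam β γ).gibbsMeasure N T) := heq ▸ hinv
  haveI : IsProbabilityMeasure ((pinnedChain ω₂ lam β γ).gibbsMeasure N T) :=
    pinnedChain_isProbabilityMeasure_gibbsMeasure hω hl.le hβ.le γ N hT
  refine ⟨fun t => hinvG t, fun ϑ hϑ0 hϑ1 => ?_⟩
  -- CEHR Prop. 3.6 from the local small set at the equilibrium, then (2.5)
  have h36 := pinnedChain_minorization_of_localSmall hω hl.le hβ hγ hN hT hT
    (pinnedChain_localSmall hω hl.le hβ hγ hN hT hT)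
  have hϑ1' : ϑ < 1 / max T T := by rwa [max_self]
  obtain ⟨C, c, hC, hc, hconv⟩ :=
    pinnedChainSemigroup_exp_convergence hω hl.le hβ hγ hN hT hT h2 h36 hϑ0 hϑ1' _ hinvG
  exact ⟨C, c, hC, hc, fun z t f hf hfV => hconv z t f hf hfV⟩

end Summit.AtomisticToContinuum.FouriersLaw.Theorems.ExtensiveSnapshotIrreversibility.ClausiusBudget

end
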